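import Summits.MatrixMultiplication.OmegaCensus.BoxUsefulNormalThreeSubgroupRank
import Summits.MatrixMultiplication.OmegaCensus.BoxBadC3C3C4Config

/-!
# ω-census, family (b3): conjecture C9 (b) — minimal normal `3`-subgroups of a centreless box-useful `{2,3}`-group are cyclic

HONEST FRAMING (pub-omega census; verbatim): lottery ticket; floor = certified bounds/negative ranges.
Census BOOKKEEPING (conjecture C9 of the cell, STRUCTURE.md §2; pub-omega kernel-l4 gen 16, task K-5, structure part; the
`p = 3` half of the centreless branch, third file).  Setting: `G` box-useful of order `2^a 3^b`, `Z(G) = 1`, `V ⊴ G` minimal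
normal, elementary abelian `3`-group.  **Theorem (`TwoThree.cyclic_of_minimal_normal`).** `V` is cyclic: every `b ∈ V` is a
power of any `a ∈ V ∖ {1}` (so `|V| = 3`).  *Proof.* Otherwise the line `⟨a⟩` is not normal, so some `p` in a Sylow
`2`-subgroup `P` moves it (`G = P · C_G(V)`).  If every `x ∈ P` has `x² ∈ C_G(V)` then `⁅p, P⁆ ⊆ C_G(V)` and
`TwoThree.inverts_or_centralizes` makes `p` invert or fix `a` — contradiction.  Otherwise take `x ∈ P` with `x² ∉ C_G(V)`,
`x⁴ ∈ C_G(V)`; `σ = ` conjugation by `x²` is an involution of `V`.  If `σ = -1` then `(a, x)` is the `C₃² ⋊ C₄`-configuration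
(`C3C3C4Config.not_boxUseful`).  If not, `σ` has a fixed element `u₀ ≠ 1` and an inverted element `u₁ ≠ 1`; by
`no_three_independent` every `σ`-inverted element is a power of `u₁`, in particular `x u₁ x⁻¹ ∈ {u₁, u₁²}`, whence
`σ(u₁) = x²u₁x⁻² = u₁ = u₁⁻¹`, `u₁ = 1` — contradiction.  Nothing here is progress on `ω`.
-/

namespace Summit.MatrixMultiplication.OmegaCensus

open Finset ProductBoxBound
open scoped commutatorElement

namespace TwoThree

variable {G : Type*} [Group G] [Fintype G] [DecidableEq G]

omit [Fintype G] [DecidableEq G] in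
/-- In exponent `3`: `u = u⁻¹` forces `u = 1`. [folklore] -/
theorem eq_one_of_eq_inv {u : G} (hu3 : u ^ 3 = 1) (h : u = u⁻¹) : u = 1 := by
  have h2 : u ^ 2 = 1 := by rw [pow_two]; nth_rw 2 [h]; exact mul_inv_cancel u
  calc u = u ^ 3 * (u ^ 2)⁻¹ := by group
    _ = 1 := by rw [hu3, h2]; group

omit [Fintype G] [DecidableEq G] in
/-- Powers of an element of order dividing `3` are `1, a, a²`. [folklore] -/
theorem pow_mem_three {a : G} (ha3 : a ^ 3 = 1) (n : ℕ) : a ^ n = 1 ∨ a ^ n = a ∨ a ^ n = a * a := by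
  have : a ^ n = a ^ (n % 3) := by
    conv_lhs => rw [← Nat.div_add_mod n 3, pow_add, pow_mul, ha3, one_pow, one_mul]
  rw [this]
  have h3 : n % 3 < 3 := Nat.mod_lt _ (by norm_num)
  interval_cases (n % 3)
  · exact Or.inl (pow_zero a)
  · exact Or.inr (Or.inl (pow_one a))
  · exact Or.inr (Or.inr (pow_two a))

/-- **Minimal normal elementary abelian `3`-subgroups of a centreless box-useful `{2,3}`-group are cyclic.** [folklore] -/
theorem cyclic_of_minimal_normal (hG : BoxUseful G) (h23 : ∀ q : ℕ, q.Prime → q ∣ Fintype.card G → q = 2 ∨ q = 3)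
    (hZ : Subgroup.center G = ⊥) (V : Subgroup G) [hVn : V.Normal] (hV3 : ∀ v ∈ V, v ^ 3 = 1)
    (hVab : ∀ v ∈ V, ∀ w ∈ V, v * w = w * v) (hV1 : V ≠ ⊥)
    (hVmin : ∀ W : Subgroup G, W.Normal → W ≤ V → W = ⊥ ∨ W = V) {a b : G} (ha : a ∈ V) (ha1 : a ≠ 1) (hb : b ∈ V) :
    b = 1 ∨ b = a ∨ b = a * a := by
  classical
  haveI : Fact (Nat.Prime 2) := ⟨Nat.prime_two⟩
  by_contra hb'
  push Not at hb'
  obtain ⟨hb1, hba, hbaa⟩ := hb'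
  set C : Subgroup G := Subgroup.centralizer (V : Set G) with hC
  haveI hCn : C.Normal := by rw [hC]; exact Subgroup.normal_centralizer
  have memC : ∀ g : G, g ∈ C ↔ ∀ v ∈ V, g * v = v * g := by
    intro g; rw [hC, Subgroup.mem_centralizer_iff]
    exact ⟨fun h v hv => (h v hv).symm, fun h v hv => (h v hv).symm⟩
  have hC3 : ∀ (t : G) (k : ℕ), t ^ 3 ^ k = 1 → t ∈ C := fun t k ht =>
    (memC t).2 (three_elt_comm_of_normal_exp_three hG V hV3 ht)
  have hVconj : ∀ g v : G, v ∈ V → g * v * g⁻¹ ∈ V := fun g v hv => hVn.conj_mem v hv g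
  obtain ⟨P⟩ : Nonempty (Sylow 2 G) := inferInstance
  have hPord : ∀ p ∈ (P : Subgroup G), ∃ i : ℕ, orderOf p = 2 ^ i := by
    intro p hp
    obtain ⟨i, hi⟩ := IsPGroup.iff_orderOf.mp P.isPGroup' ⟨p, hp⟩
    exact ⟨i, by rw [← hi, Subgroup.orderOf_mk]⟩
  ------------------------------------------------------------------
  -- (D0) some `p ∈ P` moves the line `⟨a⟩`
  obtain ⟨p, hpP, hpa⟩ : ∃ p ∈ (P : Subgroup G), ¬ (p * a * p⁻¹ = 1 ∨ p * a * p⁻¹ = a ∨ p * a * p⁻¹ = a * a) := by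
    by_contra! hall
    have hconj : ∀ g : G, g * a * g⁻¹ = 1 ∨ g * a * g⁻¹ = a ∨ g * a * g⁻¹ = a * a := by
      intro g
      obtain ⟨p, hp, c, hc, rfl⟩ := exists_mul_of_sylow_normal h23 P C hC3 g
      have : p * c * a * (p * c)⁻¹ = p * a * p⁻¹ := by
        rw [mul_inv_rev, mul_assoc p c, (memC c).1 hc a ha]; group
      rw [this]; exact hall p hp
    let L : Subgroup G := Subgroup.zpowers a
    have hLmem : ∀ x : G, x ∈ L ↔ x = 1 ∨ x = a ∨ x = a * a := by
      intro x
      constructor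
      · intro hx
        obtain ⟨n, rfl⟩ := (Submonoid.mem_powers_iff _ _).1 ((mem_powers_iff_mem_zpowers).2 hx)
        exact pow_mem_three (hV3 a ha) n
      · rintro (h | h | h) <;> rw [h]
        · exact L.one_mem
        · exact Subgroup.mem_zpowers a
        · exact L.mul_mem (Subgroup.mem_zpowers a) (Subgroup.mem_zpowers a)
    have hLn : L.Normal := ⟨by
      intro x hx g
      rw [hLmem] at hx
      have hg := hconj g
      rcases hx with h | h | h <;> rw [h]
      · rw [mul_one, mul_inv_cancel]; exact L.one_mem
      · exact (hLmem _).2 hg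
      · have : g * (a * a) * g⁻¹ = (g * a * g⁻¹) * (g * a * g⁻¹) := by group
        rw [this]
        exact L.mul_mem ((hLmem _).2 hg) ((hLmem _).2 hg)⟩
    have hLV : L ≤ V := by
      intro x hx; rw [hLmem] at hx
      rcases hx with h | h | h <;> rw [h]
      · exact V.one_mem
      · exact ha
      · exact V.mul_mem ha ha
    rcases hVmin L hLn hLV with h0 | hV
    · exact ha1 (by have := Subgroup.mem_zpowers a; rw [show Subgroup.zpowers a = L from rfl, h0, Subgroup.mem_bot] at this; exact this)
    · have : b ∈ L := by rw [hV]; exact hb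
      rw [hLmem] at this
      rcases this with e | e | e
      · exact hb1 e
      · exact hba e
      · exact hbaa e
  ------------------------------------------------------------------
  by_cases hex : ∃ x ∈ (P : Subgroup G), x * x ∉ C
  · -- (D1) an `x ∈ P` with `x² ∉ C`, `x⁴ ∈ C`
    obtain ⟨x₀, hx₀P, hx₀C⟩ := hex
    have hexm : ∃ m : ℕ, x₀ ^ 2 ^ m ∈ C := by
      obtain ⟨i, hi⟩ := hPord x₀ hx₀P
      exact ⟨i, by rw [← hi, pow_orderOf_eq_one]; exact C.one_mem⟩
    set m := Nat.find hexm with hm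
    have hmspec : x₀ ^ 2 ^ m ∈ C := Nat.find_spec hexm
    have hm2 : 2 ≤ m := by
      by_contra hlt
      have : m = 0 ∨ m = 1 := by omega
      rcases this with h0 | h1
      · rw [h0, pow_zero, pow_one] at hmspec
        exact hx₀C (C.mul_mem hmspec hmspec)
      · rw [h1, pow_one, pow_two] at hmspec; exact hx₀C hmspec
    set x := x₀ ^ 2 ^ (m - 2) with hxdef
    have hxP : x ∈ (P : Subgroup G) := Subgroup.pow_mem _ hx₀P _
    have hxx : x * x = x₀ ^ 2 ^ (m - 1) := by
      rw [hxdef, ← pow_add, ← two_mul, ← pow_succ']; congr 2; omega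
    have hx2C : x * x ∉ C := by
      rw [hxx]; exact Nat.find_min hexm (show m - 1 < m by omega)
    have hx4C : x * x * (x * x) ∈ C := by
      rw [hxx, ← pow_add, ← two_mul, ← pow_succ']
      have : m - 1 + 1 = m := by omega
      rw [this]; exact hmspec
    set s := x * x with hsdef
    clear_value s
    by_cases hinv : ∀ v ∈ V, s * v * s⁻¹ = v⁻¹
    · -- `x²` inverts `V`: the `C₃² ⋊ C₄` configuration
      have hx2a : x * x * a * x⁻¹ * x⁻¹ = a⁻¹ := by
        have := hinv a ha; rw [hsdef] at this; rw [← this]; group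
      exact C3C3C4Config.not_boxUseful (hV3 a ha) (hVab a ha _ (hVconj x a ha)) hx2a ha1 hG
    · push Not at hinv
      obtain ⟨v, hv, hvne⟩ := hinv
      obtain ⟨v', hv', hv'ne⟩ : ∃ v' ∈ V, s * v' * s⁻¹ ≠ v' := by
        by_contra! hall
        exact hx2C ((memC s).2 fun w hw => by
          calc s * w = s * w * s⁻¹ * s := by group
            _ = w * s := by rw [hall w hw])
      -- `σ = conj by s` on `V`: an involution
      have hσσ : ∀ w ∈ V, s * (s * w * s⁻¹) * s⁻¹ = w := fun w hw => by
        have := (memC _).1 hx4C w hw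
        calc s * (s * w * s⁻¹) * s⁻¹ = (s * s) * w * (s * s)⁻¹ := by group
          _ = w := by rw [this]; group
      -- fixed `u₀ ≠ 1`, inverted `u₁ ≠ 1`
      set u₀ := v * (s * v * s⁻¹) with hu₀
      set u₁ := v' * (s * v' * s⁻¹)⁻¹ with hu₁
      have hu₀V : u₀ ∈ V := V.mul_mem hv (hVconj s v hv)
      have hu₁V : u₁ ∈ V := V.mul_mem hv' (V.inv_mem (hVconj s v' hv'))
      have hu₀1 : u₀ ≠ 1 := fun h => hvne (by rw [hu₀] at h; exact (eq_inv_of_mul_eq_one_right h))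
      have hu₁1 : u₁ ≠ 1 := fun h => hv'ne (by
        rw [hu₁] at h; have := eq_inv_of_mul_eq_one_right h; rw [inv_inj] at this; exact this)
      have hσu₀ : s * u₀ * s⁻¹ = u₀ := by
        rw [hu₀]
        calc s * (v * (s * v * s⁻¹)) * s⁻¹ = (s * v * s⁻¹) * (s * (s * v * s⁻¹) * s⁻¹) := by group
          _ = (s * v * s⁻¹) * v := by rw [hσσ v hv]
          _ = v * (s * v * s⁻¹) := hVab _ (hVconj s v hv) _ hv
      have hσu₁ : s * u₁ * s⁻¹ = u₁⁻¹ := by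
        rw [hu₁]
        calc s * (v' * (s * v' * s⁻¹)⁻¹) * s⁻¹ = (s * v' * s⁻¹) * (s * (s * v' * s⁻¹) * s⁻¹)⁻¹ := by group
          _ = (s * v' * s⁻¹) * v'⁻¹ := by rw [hσσ v' hv']
          _ = (v' * (s * v' * s⁻¹)⁻¹)⁻¹ := by rw [mul_inv_rev, inv_inv]
      -- conjugation by `s` on powers
      have hσpow : ∀ w : G, ∀ n : ℕ, s * w ^ n * s⁻¹ = (s * w * s⁻¹) ^ n := fun w n => (CentreLift.conj_pow' s w n).symm
      -- every `σ`-inverted element of `V` is `1, u₁` or `u₁²`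
      have hline : ∀ u ∈ V, s * u * s⁻¹ = u⁻¹ → u = 1 ∨ u = u₁ ∨ u = u₁ * u₁ := by
        intro u hu hσu
        by_contra hnot
        push Not at hnot
        obtain ⟨hn1, hn2, hn3⟩ := hnot
        refine no_three_independent hG h23 hZ V hV3 hVab hV1 hVmin hu₀V hu₁V hu (fun p q r hp hq hr hrel => ?_)
        -- apply `σ`: `u₀^p u₁^{-q} u^{-r} = 1`
        have hrel' : u₀ ^ p * ((u₁ ^ q)⁻¹ * (u ^ r)⁻¹) = 1 := by
          have := congrArg (fun y => s * y * s⁻¹) hrel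
          rw [show s * (u₀ ^ p * (u₁ ^ q * u ^ r)) * s⁻¹ = (s * u₀ ^ p * s⁻¹) * ((s * u₁ ^ q * s⁻¹) * (s * u ^ r * s⁻¹))
            by group, hσpow, hσpow, hσpow, hσu₀, hσu₁, hσu, inv_pow, inv_pow] at this
          rw [this]; group
        -- hence `u₀^{2p} = 1`, so `p = 0`
        have hcomm1 : Commute (u₁ ^ q) (u ^ r) := (show Commute u₁ u from hVab _ hu₁V _ hu).pow_pow q r
        have h2p : u₀ ^ p * u₀ ^ p = 1 := by
          have e1 : u₀ ^ p = (u₁ ^ q * u ^ r)⁻¹ := eq_inv_of_mul_eq_one_left hrel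
          have e2 : u₀ ^ p = ((u₁ ^ q)⁻¹ * (u ^ r)⁻¹)⁻¹ := eq_inv_of_mul_eq_one_left hrel'
          have e2' : u₀ ^ p = u₁ ^ q * u ^ r := by rw [e2, mul_inv_rev, inv_inv, inv_inv, ← hcomm1.eq]
          nth_rw 1 [e1]; rw [e2', inv_mul_cancel]
        have hp0 : p = 0 := by
          interval_cases p
          · rfl
          · exfalso; rw [pow_one] at h2p
            exact hu₀1 (eq_one_of_eq_inv (hV3 u₀ hu₀V) (eq_inv_of_mul_eq_one_left h2p))
          · exfalso
            have : u₀ ^ 4 = 1 := by rw [show (4:ℕ) = 2 + 2 by rfl, pow_add]; exact h2p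
            have e : u₀ = 1 := by
              calc u₀ = u₀ ^ 4 * (u₀ ^ 3)⁻¹ := by group
                _ = 1 := by rw [this, hV3 u₀ hu₀V]; group
            exact hu₀1 e
        subst hp0
        rw [pow_zero, one_mul] at hrel
        -- `u₁^q u^r = 1`
        interval_cases r
        · rw [pow_zero, mul_one] at hrel
          interval_cases q
          · exact ⟨rfl, rfl, rfl⟩
          · exfalso; rw [pow_one] at hrel; exact hu₁1 hrel
          · exfalso
            have e : u₁ = 1 := by
              calc u₁ = u₁ ^ 3 * (u₁ ^ 2)⁻¹ := by group
                _ = 1 := by rw [hV3 u₁ hu₁V, hrel]; group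
            exact hu₁1 e
        · exfalso; rw [pow_one] at hrel
          -- `u = (u₁^q)⁻¹`
          have e : u = (u₁ ^ q)⁻¹ := eq_inv_of_mul_eq_one_right hrel
          interval_cases q
          · exact hn1 (by rw [e, pow_zero, inv_one])
          · exact hn3 (by rw [e, pow_one, (S3S3Config.inv_eq_sq (hV3 u₁ hu₁V)), pow_two])
          · exact hn2 (by
              rw [e, inv_eq_iff_mul_eq_one, ← pow_succ, hV3 u₁ hu₁V])
        · exfalso
          -- `u² = (u₁^q)⁻¹`, so `u = u⁴ = (u₁^q)⁻²`
          have e : u ^ 2 = (u₁ ^ q)⁻¹ := eq_inv_of_mul_eq_one_right hrel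
          have e' : u = (u₁ ^ q)⁻¹ * (u₁ ^ q)⁻¹ := by
            calc u = u ^ 2 * u ^ 2 * (u ^ 3)⁻¹ := by group
              _ = (u₁ ^ q)⁻¹ * (u₁ ^ q)⁻¹ := by rw [e, hV3 u hu]; group
          interval_cases q
          · exact hn1 (by rw [e', pow_zero, inv_one, mul_one])
          · exact hn2 (by
              rw [e', pow_one]
              calc u₁⁻¹ * u₁⁻¹ = (u₁ ^ 3)⁻¹ * u₁ := by group
                _ = u₁ := by rw [hV3 u₁ hu₁V]; group)
          · exact hn3 (by
              rw [e']
              calc (u₁ ^ 2)⁻¹ * (u₁ ^ 2)⁻¹ = (u₁ ^ 3)⁻¹ * (u₁ ^ 3)⁻¹ * (u₁ * u₁) := by group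
                _ = u₁ * u₁ := by rw [hV3 u₁ hu₁V]; group)
      -- `x u₁ x⁻¹` is `σ`-inverted, hence in the line of `u₁`; then `σ u₁ = u₁`
      have hxu₁V : x * u₁ * x⁻¹ ∈ V := hVconj x u₁ hu₁V
      have hσx : s * (x * u₁ * x⁻¹) * s⁻¹ = (x * u₁ * x⁻¹)⁻¹ := by
        rw [hsdef]
        calc x * x * (x * u₁ * x⁻¹) * (x * x)⁻¹ = x * (x * x * u₁ * (x * x)⁻¹) * x⁻¹ := by group
          _ = x * u₁⁻¹ * x⁻¹ := by rw [← hsdef, hσu₁]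
          _ = (x * u₁ * x⁻¹)⁻¹ := by group
      have hfix : s * u₁ * s⁻¹ = u₁ := by
        rcases hline _ hxu₁V hσx with e | e | e
        · exfalso; apply hu₁1
          calc u₁ = x⁻¹ * (x * u₁ * x⁻¹) * x := by group
            _ = 1 := by rw [e]; group
        · rw [hsdef]
          calc x * x * u₁ * (x * x)⁻¹ = x * (x * u₁ * x⁻¹) * x⁻¹ := by group
            _ = u₁ := by rw [e, e]
        · rw [hsdef]
          calc x * x * u₁ * (x * x)⁻¹ = x * (x * u₁ * x⁻¹) * x⁻¹ := by group
            _ = x * (u₁ * u₁) * x⁻¹ := by rw [e]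
            _ = (x * u₁ * x⁻¹) * (x * u₁ * x⁻¹) := by group
            _ = u₁ * u₁ * (u₁ * u₁) := by rw [e]
            _ = u₁ ^ 3 * u₁ := by simp only [pow_succ, pow_zero, one_mul, mul_assoc]
            _ = u₁ := by rw [hV3 u₁ hu₁V, one_mul]
      rw [hfix] at hσu₁
      exact hu₁1 (eq_one_of_eq_inv (hV3 u₁ hu₁V) hσu₁)
  · -- (D2) every `x ∈ P` has `x² ∈ C`: `⁅p, P⁆ ⊆ C`, and `p` inverts or centralises `V`
    push Not at hex
    have hpP' : ∀ q ∈ (P : Subgroup G), p * q * p⁻¹ * q⁻¹ ∈ C := by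
      intro q hq
      have e : p * q * p⁻¹ * q⁻¹ = (p * q) * (p * q) * (q⁻¹ * (p * p)⁻¹ * q) * (q * q)⁻¹ := by group
      rw [e]
      refine C.mul_mem (C.mul_mem (hex _ (P.1.mul_mem hpP hq)) ?_) (C.inv_mem (hex q hq))
      exact hCn.conj_mem' _ (C.inv_mem (hex p hpP)) q
    rcases inverts_or_centralizes h23 V hVab hVmin P hC3 hpP' (hex p hpP) with hi | hc
    · exact hpa (Or.inr (Or.inr (by rw [hi a ha, S3S3Config.inv_eq_sq (hV3 a ha), pow_two])))
    · exact hpa (Or.inr (Or.inl (hc a ha)))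

end TwoThree

end Summit.MatrixMultiplication.OmegaCensus
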